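import Literature.NumberTheory.ComplexMultiplication.CMAlgebraLatticeKernelUnitIndex
import Literature.NumberTheory.ComplexMultiplication.CMAlgebraLatticeClassesClassGroup
import HarnessLib

/-!
# The CLASS NUMBER FORMULA of an ORDER `Λ` in a CM-ALGEBRA `Y = L_1 ⊕ ⋯ ⊕ L_t`:
# `#G([Λ]_ε) · [𝒪_Y^{unit} : Λ^{unit}] = (∏ᵢ h(Lᵢ)) · #((𝒪_Y/𝔣)^{unit}/(Λ/𝔣)^{unit})`, `𝔣 = Λ:𝒪_Y` the conductor
# (Hertling–Larabi 2026 Thm. 8.2 (f) (8.10) with `Λ_1 = Λ_max = 𝒪_Y`, Cor. 6.2 (c); Neukirch (12.12) for one field)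

[node N13c] [stratum S1] [book HertlingLarabi2026 > §8 > Thm. 8.2 (f); §6 > Thm. 6.1, Cor. 6.2]

Topic `Literature/NumberTheory/ComplexMultiplication`, namespace `Literature.NumberTheory.ComplexMultiplication`;
lane `lit-hodgefound` (Track 2 foundations library), Layer A3, seat p19 generation 32, row g32-#10 — the
relative formula of g32-#8 (`CMAlgebraLatticeKernelUnitIndex`, `natCard_quot_pic_mul_relIndex_eq`, arbitrary
orders `Λ_2 ⊆ Λ_1`) specialised to the MAXIMAL order `Λ_1 = 𝒪_Y = ⊕ᵢ 𝒪_{Lᵢ}`, whose Picard set g31-#3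
(`CMAlgebraLatticeClassesClassGroup`, `natCard_quot_isFullLattice_pi_eq_prod_classNumber`) counted as
`∏ᵢ h(Lᵢ)`.  The tree's ONE-FIELD formula is `CMOrderClassNumberFormula` (`R ⊂ 𝒪_K`, Mathlib's `ClassGroup`);
this is the multi-field CM-algebra form in the lattice vocabulary.  THEOREMS ONLY: no definition, no instance, no
named fact (D-0026, net Literature debt `0`), no `sorry`.

## Source, VERBATIM

C. Hertling, K. Larabi, *Semigroups from full lattices in commutative ℚ-algebras*, arXiv:2602.14973 (2026)
[HertlingLarabi2026], held `paper:arxiv-2602.14973`.  §6 (chunk p0015): «**Theorem 6.1.** […] (b) Each full lattice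
`L` with `𝒪(L) = Λ_max(A)` is invertible. (c) The group `G([Λ_max]_ε)` […] is finite. It is the class group of `A`.
**Corollary 6.2.** Let `A` be separable […] (c) The group `G([Λ_max]_ε)` is finite and isomorphic to the product
`∏_{j=1}^k G([Λ_max(A^{(j)})]_ε)` of the class groups of the algebraic number fields `A^{(1)}, …, A^{(k)}`.»  §8
(chunks p0021, p0023): «**Theorem 8.2.** […] (f) […] `|G([Λ_2]_ε)|/|G([Λ_1]_ε)| = |(Λ_1/C)^{unit}|/|(Λ_2/C)^{unit}| ·
1/[Λ_1^{unit} : Λ_2^{unit}]`. […] **Remarks 8.3.** Comparing Theorem 8.2 with [Ne99], this reference has the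
following restrictions and differences. There `A` is an algebraic number field, `Λ_1` is the maximal order `Λ_max`
in `A`, and localization is done by prime ideals in `Λ_2`. […] Theorem (12.12) in [Ne99] is a special case of part
(f) of Theorem 8.2.»

## Contents

* §1 `order_le_pi_integralClosure` (every order of `Y` lies in `𝒪_Y`), `pic_pi_integralClosure_iff` (for a full
  lattice `M`: `M𝒪_Y ⊆ M` iff `𝒪(M) = 𝒪_Y` and `M` is invertible — Thm. 6.1 (b) ∕ Cor. 6.2 (b) via the tree's
  `mul_div_eq_of_div_self_eq_pi`), `natCard_quot_pic_pi_integralClosure_eq_prod_classNumber`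
  (`#G([𝒪_Y]_ε) = ∏ᵢ h(Lᵢ)` in g32-#1's `G(R)`-vocabulary).
* §2 **`natCard_quot_pic_mul_relIndex_eq_prod_classNumber_mul`**: for every order `Λ` of `Y`,
  `#G([Λ]_ε) · [𝒪_Y^{unit} : Λ^{unit}] = (∏ᵢ h(Lᵢ)) · #((𝒪_Y/𝔣)^{unit}/(Λ/𝔣)^{unit})`.

## References

* [HL26] C. Hertling, K. Larabi, arXiv:2602.14973 (2026), §6 Thm. 6.1, Cor. 6.2 (chunk p0015), §8 Thm. 8.2 (f),
  Rem. 8.3 (chunks p0021, p0023). [cite: HertlingLarabi2026]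
* [Ne99] J. Neukirch, *Algebraic Number Theory*, Grundlehren 322 (1999), I §12 Thm. (12.12):
  `h(𝒪) = h_K/[𝒪_K^* : 𝒪^*] · #(𝒪_K/𝔣)^*/#(𝒪/𝔣)^*`. [cite: NeukirchANT1999]
* [Sh98] G. Shimura, *Abelian Varieties with Complex Multiplication and Modular Functions* (1998), §7.4 Prop. 17,
  p. 58 (`h` principal abelian varieties of a given CM-type). [cite: Shimura1998]
-/

noncomputable section

open scoped Classical Pointwise nonZeroDivisors NumberField
open Module NumberField Function

namespace Literature.NumberTheory.ComplexMultiplication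

open Literature.NumberTheory.Automorphic

section OrderClassNumber

variable {t : Type} {L : t → Type} [∀ i, Field (L i)] [∀ i, NumberField (L i)] [Fintype t] [DecidableEq t]

/-! ## §1 The maximal order `𝒪_Y` and its Picard set -/

omit [Fintype t] [DecidableEq t] in
/-- **Every order `Λ` of `Y` lies in the maximal order `𝒪_Y = ⊕ᵢ 𝒪_{Lᵢ}`** (`𝒪(Λ) = Λ` consists of integral
elements). [cite: HertlingLarabi2026, §6 Thm. 6.1 (a) («a maximal order Λ_max(A), which contains all other orders»), Cor. 6.2 (a), chunk p0015] -/
theorem order_le_pi_integralClosure {Λ : Submodule ℤ (Π i, L i)} (hΛ : IsFullLattice (Π i, L i) Λ)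
    (hΛΛ : Λ * Λ ≤ Λ) :
    Λ ≤ Submodule.pi Set.univ (fun i => Subalgebra.toSubmodule (integralClosure ℤ (L i))) := fun _ ha =>
  mem_piIntegralSubmodule_iff.2 fun i =>
    isIntegral_apply_of_forall_mul_mem hΛ (fun _ hm => hΛΛ (Submodule.mul_mem_mul hm ha)) i

omit [DecidableEq t] in
/-- **THEOREM 6.1 (b) ∕ COR. 6.2 (b): a full lattice `M ⊂ Y` is `𝒪_Y`-stable iff its order is `𝒪_Y` and it is
invertible** (`𝒪(M) ⊇ 𝒪_Y` forces `𝒪(M) = 𝒪_Y` as `𝒪(M)` is integral; invertibility by the tree's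
`mul_div_eq_of_div_self_eq_pi`). [cite: HertlingLarabi2026, §6 Thm. 6.1 (b), Cor. 6.2 (b), chunk p0015]
[cite: Marseglia2019, §3 («if R = 𝒪_K is the maximal order of K, then ICM(𝒪_K) = Pic(𝒪_K)»), p. 6] -/
theorem pic_pi_integralClosure_iff {M : Submodule ℤ (Π i, L i)} (hM : IsFullLattice (Π i, L i) M) :
    (∀ m ∈ M, ∀ a ∈ Submodule.pi Set.univ (fun i => Subalgebra.toSubmodule (integralClosure ℤ (L i))),
        m * a ∈ M) ↔
      M / M = Submodule.pi Set.univ (fun i => Subalgebra.toSubmodule (integralClosure ℤ (L i))) ∧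
        M * ((M / M) / M) = M / M := by
  constructor
  · intro h
    have hO : M / M = Submodule.pi Set.univ (fun i => Subalgebra.toSubmodule (integralClosure ℤ (L i))) := by
      refine le_antisymm (fun a ha => mem_piIntegralSubmodule_iff.2 fun i => ?_) fun a ha => ?_
      · exact isIntegral_apply_of_forall_mul_mem hM
          (fun m hm => by rw [mul_comm]; exact (Submodule.mem_div_iff_forall_mul_mem.1 ha) m hm) i
      · exact Submodule.mem_div_iff_forall_mul_mem.2 fun m hm => by rw [mul_comm]; exact h m hm a ha
    refine ⟨hO, ?_⟩
    have h2 := mul_div_eq_of_div_self_eq_pi hM hO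
    rwa [← hO] at h2
  · rintro ⟨hO, -⟩ m hm a ha
    rw [← hO] at ha
    rw [mul_comm]
    exact (Submodule.mem_div_iff_forall_mul_mem.1 ha) m hm

/-- **COR. 6.2 (c): `#G([𝒪_Y]_ε) = ∏ᵢ h(Lᵢ)`** in the `G(R)`-vocabulary of g32-#1 (full, `𝒪(M) = 𝒪_Y`, invertible;
transported from g31-#3's `𝒪_Y`-stable form by `pic_pi_integralClosure_iff`).
[cite: HertlingLarabi2026, §6 Cor. 6.2 (c), chunk p0015] [cite: Shimura1998, §7.4 Prop. 17, p. 58] -/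
theorem natCard_quot_pic_pi_integralClosure_eq_prod_classNumber :
    Nat.card (Quot (fun M M' : {M : Submodule ℤ (Π i, L i) //
        (IsFullLattice (Π i, L i) M ∧
          M / M = Submodule.pi Set.univ (fun i => Subalgebra.toSubmodule (integralClosure ℤ (L i)))) ∧
          M * ((M / M) / M) = M / M} =>
      ∃ u : (Π i, L i)ˣ, u • (M : Submodule ℤ (Π i, L i)) = M')) = ∏ i, classNumber (L i) := by
  rw [← natCard_quot_isFullLattice_pi_eq_prod_classNumber (L := L)]
  have himp : ∀ M : Submodule ℤ (Π i, L i),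
      ((IsFullLattice (Π i, L i) M ∧
          M / M = Submodule.pi Set.univ (fun i => Subalgebra.toSubmodule (integralClosure ℤ (L i)))) ∧
          M * ((M / M) / M) = M / M) ↔
      (IsFullLattice (Π i, L i) M ∧ ∀ m ∈ M,
        ∀ a ∈ Submodule.pi Set.univ (fun i => Subalgebra.toSubmodule (integralClosure ℤ (L i))), m * a ∈ M) :=
    fun M => ⟨fun h => ⟨h.1.1, (pic_pi_integralClosure_iff h.1.1).2 ⟨h.1.2, h.2⟩⟩,
      fun h => ⟨⟨h.1, ((pic_pi_integralClosure_iff h.1).1 h.2).1⟩, ((pic_pi_integralClosure_iff h.1).1 h.2).2⟩⟩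
  refine Nat.card_congr
    { toFun := Quot.map (fun M => ⟨M.1, (himp M.1).1 M.2⟩) fun M M' h => h
      invFun := Quot.map (fun M => ⟨M.1, (himp M.1).2 M.2⟩) fun M M' h => h
      left_inv := fun q => Quot.inductionOn q fun M => rfl
      right_inv := fun q => Quot.inductionOn q fun M => rfl }

/-! ## §2 The class number formula of an order of `Y` -/

/-- **THE CLASS NUMBER FORMULA OF AN ORDER `Λ` OF A CM-ALGEBRA `Y = ∏ᵢ Lᵢ`:
`#G([Λ]_ε) · [𝒪_Y^{unit} : Λ^{unit}] = (∏ᵢ h(Lᵢ)) · #((𝒪_Y/𝔣)^{unit}/(Λ/𝔣)^{unit})`, `𝔣 = Λ:𝒪_Y`** — Thm. 8.2 (f)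
(8.10) for `Λ_1 = Λ_max = 𝒪_Y` (g32-#8) with `#G([𝒪_Y]_ε) = ∏ᵢ h(Lᵢ)` (Cor. 6.2 (c), §1); for one CM field this
is Neukirch's Theorem (12.12) `h(𝒪) = h_K/[𝒪_K^* : 𝒪^*] · #(𝒪_K/𝔣)^*/#(𝒪/𝔣)^*`. All factors are `Nat.card`s of the
g32-#1/#8 `Quot` types and a `Subgroup.relIndex` (nonzero: g32-#9).
[cite: HertlingLarabi2026, §8 Thm. 8.2 (f) (8.10) and Rem. 8.3 («Theorem (12.12) in [Ne99] is a special case of part (f)»), chunks p0021, p0023; §6 Cor. 6.2 (c), chunk p0015]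
[cite: NeukirchANT1999, I §12 Thm. (12.12)] -/
theorem natCard_quot_pic_mul_relIndex_eq_prod_classNumber_mul {Λ : Submodule ℤ (Π i, L i)}
    (hΛ : IsFullLattice (Π i, L i) Λ) (h1 : (1 : Π i, L i) ∈ Λ) (hΛΛ : Λ * Λ ≤ Λ) :
    Nat.card (Quot (fun M M' : {M : Submodule ℤ (Π i, L i) //
        (IsFullLattice (Π i, L i) M ∧ M / M = Λ) ∧ M * ((M / M) / M) = M / M} =>
      ∃ u : (Π i, L i)ˣ, u • (M : Submodule ℤ (Π i, L i)) = M')) *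
      (MulAction.stabilizer (Π i, L i)ˣ Λ).relIndex (MulAction.stabilizer (Π i, L i)ˣ
        (Submodule.pi Set.univ (fun i => Subalgebra.toSubmodule (integralClosure ℤ (L i))))) =
    (∏ i, classNumber (L i)) *
    Nat.card (Quot (fun a b : {a : Π i, L i //
        a ∈ Submodule.pi Set.univ (fun i => Subalgebra.toSubmodule (integralClosure ℤ (L i))) ∧
        ∃ a' ∈ Submodule.pi Set.univ (fun i => Subalgebra.toSubmodule (integralClosure ℤ (L i))),
          a * a' - 1 ∈ Λ / Submodule.pi Set.univ (fun i => Subalgebra.toSubmodule (integralClosure ℤ (L i)))} =>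
        ∃ v ∈ Λ, (∃ v' ∈ Λ, v * v' - 1 ∈
          Λ / Submodule.pi Set.univ (fun i => Subalgebra.toSubmodule (integralClosure ℤ (L i)))) ∧
          (b : Π i, L i) - a * v ∈
            Λ / Submodule.pi Set.univ (fun i => Subalgebra.toSubmodule (integralClosure ℤ (L i))))) := by
  have hO : IsFullLattice (Π i, L i)
      (Submodule.pi Set.univ (fun i => Subalgebra.toSubmodule (integralClosure ℤ (L i)))) :=
    isFullLattice_piIntegralSubmodule
  have hOO : Submodule.pi Set.univ (fun i => Subalgebra.toSubmodule (integralClosure ℤ (L i))) *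
      Submodule.pi Set.univ (fun i => Subalgebra.toSubmodule (integralClosure ℤ (L i))) ≤
      Submodule.pi Set.univ (fun i => Subalgebra.toSubmodule (integralClosure ℤ (L i))) :=
    Submodule.mul_le.2 fun a ha b hb => mul_mem_piIntegralSubmodule ha hb
  rw [natCard_quot_pic_mul_relIndex_eq hO one_mem_piIntegralSubmodule hOO hΛ h1 hΛΛ
    (order_le_pi_integralClosure hΛ hΛΛ), natCard_quot_pic_pi_integralClosure_eq_prod_classNumber]

end OrderClassNumber

end Literature.NumberTheory.ComplexMultiplication
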